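import Mathlib.Analysis.SpecialFunctions.Trigonometric.ArctanDeriv
import Mathlib.Analysis.SpecialFunctions.Trigonometric.InverseDeriv
import Mathlib.Analysis.SpecialFunctions.ExpDeriv
import Mathlib.Analysis.Calculus.Deriv.Inv
import HarnessLib

/-!
# The angular twist in polar coordinates

Topic `Literature/Topology/FourManifolds`; fact seat `provefact-IsStrictHandleSlide.isSurgery`
(R. C. Kirby, *The Topology of 4-Manifolds*, LNM 1374 (1989), Ch. I §4; remaining content: the
named fact (S) `Literature.Topology.FourManifolds.FramedLink.IsStrictHandleSlide.slideModel`).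
The twisted chart `Λ` of the pillbox sweep (`KirbyMovesSlideSweepExchange.exists_twistDiffeomorph`,
`KirbyMovesSlideSweepExchange2.exists_planarSweep`) maps the point with polar coordinates `(r, θ)`
to the point with polar coordinates `(r, α)`, `tan (α/2) = e^{c r} tan (θ/2)`. This file introduces
the **twist angle** `twistAngle c r θ = 2 arctan (e^{c r} tan (θ/2))` (`θ ∈ (-π, π)`) and proves
the identities behind that description: the Cartesian formulas of `exists_twistDiffeomorph` are
`(cos α, sin α)`, the inverse twist is the twist with `-c`, monotonicity in `θ`, and the partial
derivatives `∂α/∂θ = e^{cr} / (cos² (θ/2) + e^{2cr} sin² (θ/2))`, `∂α/∂r = c sin α`.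

* `Literature.Topology.FourManifolds.twistAngle` (definition) and its API (`twistAngle_zero`,
  `twistAngle_neg`, `twistAngle_mem_Ioo`, `cos_twistAngle`, `sin_twistAngle`,
  `twistAngle_twistAngle_neg`, `strictMonoOn_twistAngle`, `hasDerivAt_twistAngle_theta`,
  `hasDerivAt_twistAngle_radius`, `contDiffOn_twistAngle`).

## References

* R. C. Kirby, *The Topology of 4-Manifolds*, LNM 1374, Springer (1989), Ch. I §4. [Kirby1989]
* M. W. Hirsch, *Differential Topology* (1976), Ch. 8 §1. [HirschDT1976]
-/

open scoped Topology Real ContDiff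
open Set Real

noncomputable section

namespace Literature.Topology.FourManifolds

/-- **The twist angle**: the polar angle of the image under the angular twist with parameter `c`
of the point with polar coordinates `(r, θ)`, `θ ∈ (-π, π)`: `2 arctan (e^{c r} tan (θ/2))`.
[cite: HirschDT1976, Ch. 8 §1] -/
def twistAngle (c r θ : ℝ) : ℝ := 2 * arctan (exp (c * r) * tan (θ / 2))

/-- Unfolding lemma. [folklore] -/
theorem twistAngle_def (c r θ : ℝ) : twistAngle c r θ = 2 * arctan (exp (c * r) * tan (θ / 2)) := rfl

/-- The twist fixes the ray `θ = 0`. [folklore] -/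
@[simp] theorem twistAngle_zero (c r : ℝ) : twistAngle c r 0 = 0 := by simp [twistAngle]

/-- The twist angle is odd in `θ`. [folklore] -/
theorem twistAngle_neg (c r θ : ℝ) : twistAngle c r (-θ) = -twistAngle c r θ := by
  simp [twistAngle, neg_div, tan_neg, arctan_neg, mul_neg]

/-- With `c = 0` (or `r = 0`) the twist is the identity on `(-π, π)`. [folklore] -/
theorem twistAngle_of_mul_eq_zero {c r θ : ℝ} (h : c * r = 0) (hθ : θ ∈ Ioo (-π) π) : twistAngle c r θ = θ := by
  rw [twistAngle, h, exp_zero, one_mul, arctan_tan (by linarith [hθ.1]) (by linarith [hθ.2])]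
  ring

/-- The twist angle lies in `(-π, π)`. [folklore] -/
theorem twistAngle_mem_Ioo (c r θ : ℝ) : twistAngle c r θ ∈ Ioo (-π) π := by
  have h1 := arctan_lt_pi_div_two (exp (c * r) * tan (θ / 2))
  have h2 := neg_pi_div_two_lt_arctan (exp (c * r) * tan (θ / 2))
  constructor <;> rw [twistAngle] <;> linarith

/-- `tan (α/2) = e^{c r} tan (θ/2)`. [folklore] -/
theorem tan_twistAngle_div_two (c r θ : ℝ) : tan (twistAngle c r θ / 2) = exp (c * r) * tan (θ / 2) := by
  rw [twistAngle, mul_div_cancel_left₀ _ two_ne_zero, tan_arctan]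

/-- `cos α` in terms of `T = e^{cr} tan (θ/2)`: `(1 - T²)/(1 + T²)`. [folklore] -/
theorem cos_twistAngle_eq (c r θ : ℝ) :
    cos (twistAngle c r θ) = (1 - (exp (c * r) * tan (θ / 2)) ^ 2) / (1 + (exp (c * r) * tan (θ / 2)) ^ 2) := by
  rw [twistAngle, cos_two_mul, cos_sq_arctan]
  have h : (1 + (exp (c * r) * tan (θ / 2)) ^ 2) ≠ 0 := by positivity
  field_simp
  ring

/-- `sin α` in terms of `T = e^{cr} tan (θ/2)`: `2T/(1 + T²)`. [folklore] -/
theorem sin_twistAngle_eq (c r θ : ℝ) :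
    sin (twistAngle c r θ) = 2 * (exp (c * r) * tan (θ / 2)) / (1 + (exp (c * r) * tan (θ / 2)) ^ 2) := by
  rw [twistAngle, sin_two_mul, sin_arctan, cos_arctan]
  set T := exp (c * r) * tan (θ / 2) with hT
  have h : 0 < 1 + T ^ 2 := by positivity
  set S := sqrt (1 + T ^ 2) with hS
  have hS0 : S ≠ 0 := (sqrt_pos.2 h).ne'
  have hS2 : S ^ 2 = 1 + T ^ 2 := sq_sqrt h.le
  rw [← hS2]
  field_simp

/-- **The Cartesian formula of the twist** (`exists_twistDiffeomorph`) is `(cos α, sin α)`: for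
`θ ∈ (-π, π)`, `a = cos θ`, `b = sin θ`, `E = e^{cr}`,
`cos α = ((1 + a) - E² (1 - a)) / ((1 + a) + E² (1 - a))`. [folklore] -/
theorem cos_twistAngle {c r θ : ℝ} (hθ : θ ∈ Ioo (-π) π) :
    cos (twistAngle c r θ) = ((1 + cos θ) - exp (c * r) ^ 2 * (1 - cos θ)) /
      ((1 + cos θ) + exp (c * r) ^ 2 * (1 - cos θ)) := by
  have hc : 0 < cos (θ / 2) := cos_pos_of_mem_Ioo ⟨by linarith [hθ.1], by linarith [hθ.2]⟩
  have h1 : 1 + cos θ = 2 * cos (θ / 2) ^ 2 := by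
    have := cos_sq (θ / 2); rw [show 2 * (θ / 2) = θ by ring] at this; linarith
  have h2 : 1 - cos θ = 2 * sin (θ / 2) ^ 2 := by
    have := sin_sq_add_cos_sq (θ / 2); linarith
  rw [cos_twistAngle_eq, tan_eq_sin_div_cos, h1, h2]
  have hE : 0 < exp (c * r) := exp_pos _
  have hc2 : cos (θ / 2) ≠ 0 := hc.ne'
  rw [div_eq_div_iff (by positivity) (by positivity)]
  field_simp

/-- **The Cartesian formula of the twist**, second coordinate:
`sin α = 2 E b / ((1 + a) + E² (1 - a))`. [folklore] -/
theorem sin_twistAngle {c r θ : ℝ} (hθ : θ ∈ Ioo (-π) π) :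
    sin (twistAngle c r θ) = 2 * exp (c * r) * sin θ / ((1 + cos θ) + exp (c * r) ^ 2 * (1 - cos θ)) := by
  have hc : 0 < cos (θ / 2) := cos_pos_of_mem_Ioo ⟨by linarith [hθ.1], by linarith [hθ.2]⟩
  have h1 : 1 + cos θ = 2 * cos (θ / 2) ^ 2 := by
    have := cos_sq (θ / 2); rw [show 2 * (θ / 2) = θ by ring] at this; linarith
  have h2 : 1 - cos θ = 2 * sin (θ / 2) ^ 2 := by
    have := sin_sq_add_cos_sq (θ / 2); linarith
  have h3 : sin θ = 2 * sin (θ / 2) * cos (θ / 2) := by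
    rw [← sin_two_mul]; ring_nf
  rw [sin_twistAngle_eq, tan_eq_sin_div_cos, h1, h2, h3]
  have hE : 0 < exp (c * r) := exp_pos _
  have hc2 : cos (θ / 2) ≠ 0 := hc.ne'
  rw [div_eq_div_iff (by positivity) (by positivity)]
  field_simp

/-- **The inverse twist is the twist with `-c`.** [folklore] -/
theorem twistAngle_twistAngle_neg (c r : ℝ) {θ : ℝ} (hθ : θ ∈ Ioo (-π) π) :
    twistAngle (-c) r (twistAngle c r θ) = θ := by
  rw [twistAngle, tan_twistAngle_div_two, ← mul_assoc, neg_mul, ← exp_add, neg_add_cancel, exp_zero, one_mul,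
    arctan_tan (by linarith [hθ.1]) (by linarith [hθ.2])]
  ring

/-- The twist angle is strictly increasing in `θ` on `(-π, π)`. [folklore] -/
theorem strictMonoOn_twistAngle (c r : ℝ) : StrictMonoOn (twistAngle c r) (Ioo (-π) π) := by
  intro θ hθ θ' hθ' hlt
  unfold twistAngle
  have hE : 0 < exp (c * r) := exp_pos _
  have ht : tan (θ / 2) < tan (θ' / 2) := by
    apply strictMonoOn_tan ⟨by linarith [hθ.1], by linarith [hθ.2]⟩ ⟨by linarith [hθ'.1], by linarith [hθ'.2]⟩
    linarith
  have := arctan_strictMono (mul_lt_mul_of_pos_left ht hE)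
  linarith

/-- The twist angle is `C^∞` in `(r, θ)` on `ℝ × (-π, π)`. [folklore] -/
theorem contDiffOn_twistAngle (c : ℝ) :
    ContDiffOn ℝ ∞ (fun p : ℝ × ℝ ↦ twistAngle c p.1 p.2) (univ ×ˢ Ioo (-π) π) := by
  have h1 : ContDiffOn ℝ ∞ (fun p : ℝ × ℝ ↦ exp (c * p.1) * tan (p.2 / 2)) (univ ×ˢ Ioo (-π) π) := by
    refine ((contDiff_exp.comp (contDiff_const.mul contDiff_fst)).contDiffOn).mul ?_
    intro p hp
    have hp2 : p.2 ∈ Ioo (-π) π := hp.2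
    have hc : cos (p.2 / 2) ≠ 0 := (cos_pos_of_mem_Ioo ⟨by linarith [hp2.1], by linarith [hp2.2]⟩).ne'
    exact ((contDiffAt_tan.2 hc).comp p ((contDiffAt_snd.div_const 2))).contDiffWithinAt
  exact contDiffOn_const.mul (contDiff_arctan.comp_contDiffOn h1)

/-- **`∂α/∂θ`**: `d/dθ twistAngle c r θ = E / (cos² (θ/2) + E² sin² (θ/2))` (`E = e^{cr}`), in
particular positive. [folklore] -/
theorem hasDerivAt_twistAngle_theta (c r : ℝ) {θ : ℝ} (hθ : θ ∈ Ioo (-π) π) :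
    HasDerivAt (twistAngle c r) (exp (c * r) / (cos (θ / 2) ^ 2 + exp (c * r) ^ 2 * sin (θ / 2) ^ 2)) θ := by
  have hc : 0 < cos (θ / 2) := cos_pos_of_mem_Ioo ⟨by linarith [hθ.1], by linarith [hθ.2]⟩
  set E := exp (c * r) with hE
  have hEp : 0 < E := exp_pos _
  -- derivative of `θ ↦ E tan (θ/2)`
  have ht : HasDerivAt (fun θ ↦ E * tan (θ / 2)) (E * (1 / cos (θ / 2) ^ 2 * (1 / 2))) θ := by
    have h := (hasDerivAt_tan hc.ne').comp θ ((hasDerivAt_id θ).div_const 2)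
    exact (h.const_mul E).congr_deriv (by simp)
  have ha := (hasDerivAt_arctan (E * tan (θ / 2))).comp θ ht
  have h2 := ha.const_mul 2
  refine h2.congr_deriv ?_
  have hc2 : cos (θ / 2) ≠ 0 := hc.ne'
  have hden : cos (θ / 2) ^ 2 + E ^ 2 * sin (θ / 2) ^ 2 ≠ 0 := by positivity
  rw [tan_eq_sin_div_cos]
  field_simp

/-- The `θ`-derivative of the twist angle is positive. [folklore] -/
theorem deriv_twistAngle_theta_pos (c r : ℝ) {θ : ℝ} (hθ : θ ∈ Ioo (-π) π) : 0 < deriv (twistAngle c r) θ := by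
  rw [(hasDerivAt_twistAngle_theta c r hθ).deriv]
  have hc : 0 < cos (θ / 2) := cos_pos_of_mem_Ioo ⟨by linarith [hθ.1], by linarith [hθ.2]⟩
  have hE : 0 < exp (c * r) := exp_pos _
  positivity

/-- **`∂α/∂r = c sin α`.** [folklore] -/
theorem hasDerivAt_twistAngle_radius (c θ r : ℝ) :
    HasDerivAt (fun r ↦ twistAngle c r θ) (c * sin (twistAngle c r θ)) r := by
  set k := tan (θ / 2) with hk
  have he : HasDerivAt (fun r ↦ exp (c * r) * k) (c * exp (c * r) * k) r := by
    have h1 : HasDerivAt (fun r ↦ c * r) c r := by simpa using (hasDerivAt_id r).const_mul c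
    have := h1.exp.mul_const k
    refine this.congr_deriv ?_
    ring
  have ha := ((hasDerivAt_arctan (exp (c * r) * k)).comp r he).const_mul 2
  refine ha.congr_deriv ?_
  rw [sin_twistAngle_eq]
  field_simp
  ring

end Literature.Topology.FourManifolds
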